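import Mathlib.Algebra.DualNumber
import Mathlib.Algebra.MvPolynomial.CommRing
import Mathlib.Algebra.MvPolynomial.Nilpotent
import Mathlib.RingTheory.MvPolynomial.Ideal
import Mathlib.RingTheory.Ideal.Maps
import Mathlib.RingTheory.PrincipalIdealDomain
import Mathlib.RingTheory.Localization.FractionRing
import Mathlib.Tactic.FinCases
import Mathlib.Tactic.LinearCombination
import Mathlib.Tactic.Ring
import HarnessLib

/-!
# Junction lemma J2 (cuspidal transversal type), part 1: the ideal of `Σ ∪ R` and its trace on `{v² = u³} × 𝔸¹`

[OURS · L1 W4.5(b)] Helper for the research stub `stub_elnat_three` of the crux `EquisingularLiftNat`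
(stmt-ResolutionOfSingularities-20038; route `EquisingularLift`, chain w45b, CRUX-PLAN v3 §1.6 «NO-DAMAGE
(J2)» / §4 `junction_cusp_resolves`). NOT a statement of any manuscript; AI-written kernel lemma of the
cell `res-hironaka` (weaker than expert review). Part 2 (`…NatJunctionCusp.lean`) proves that the
blowing up of `H` along `X` is the normalisation; this file supplies the ideal-theoretic facts.

**The model.** `k` a field; `H = {v² = u³} × 𝔸¹_w ⊂ 𝔸³_{u,v,w}` the cuspidal cylinder, with
coordinate ring `k[s², s³, w] ⊆ k[s, w]` (the image `φ.range` of `φ : k[u,v,w] → k[s,w]`,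
`(u, v, w) ↦ (s², s³, w)`, `cuspParam_eq_zero`; `k[s, w]` is its normalisation); `Σ = {u = v = 0}` its
singular line; `R = {u = w², v = w³} ⊂ H` the single-sheet companion (the image of `s = w`), meeting
`Σ` at the origin only; `X = Σ ∪ R`, `I_X = (u, v) ∩ (u − w², v − w³)`.

**Proved here** (all `[folklore]`-level commutative algebra; variables `X 0, X 1, X 2 = u, v, w` of
`MvPolynomial (Fin 3) k` and `X 0, X 1 = s, w` of `MvPolynomial (Fin 2) k`; the objects are pinned
by the equational hypotheses `hφ`, `hI` instead of definitions):
* `span_inf_span_eq` — `I_X = (v − uw, u(u − w²))` (over any commutative ring): `X` is the tacnode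
  `u(u − w²) = 0` in the smooth germ `v = uw` (CRUX-PLAN v3 §1.6: «the companion comes out TANGENT to `Σ`,
  tacnode inside the smooth germ»);
* `map_rangeRestrict_junctionIdeal`, `cuspParam_gens` — the trace `I := I_X · 𝒪_H` is generated by
  `s³ − s²w` and `s⁴ − s²w² = (s³ − s²w)(s + w)` (CRUX-PLAN: «`𝓘_X·𝒪_H = (s³ − s²w, s⁴ − s²w²)`»);
* `mem_traceIdeal_iff` — `I = (s³ − s²w) · k[s, w]` (a conductor-multiple ideal: `s²(s − w)` is a
  universal denominator of the normalisation, `gen_mul_mem_range`), `X_zero_notMem_range` —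
  `s ∉ k[s², s³, w]` (dual-number test point), `exists_add_X_mul_of_range` — `k[s,w] = 𝒪_H + s 𝒪_H`;
* `traceIdeal_not_isPrincipal` — `I` is NOT principal (CRUX-PLAN: «NOT principal in `k[[s²,s³,w]]`»;
  the centre is useful: `Bl_X` is not an isomorphism on `H`);
* `traceIdeal_sq` — `x² ∈ (s³ − s²w) · I` for `x ∈ I` (one chart of the blowing up suffices).

What is NOT here: the power-series (complete local) version (flat base change; not needed).
References: folklore commutative algebra; the plan's hand computation CRUX-PLAN v3 §1.6 (cell-internal).
-/
-- single-problem summit: the doubled namespace component `ResolutionOfSingularities` is forced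
set_option linter.dupNamespace false

noncomputable section

open MvPolynomial

namespace Summit.ResolutionOfSingularities.ResolutionOfSingularities.Theorems.EquisingularLift.Junction

universe u

section IdealOfX

variable {R : Type u} [CommRing R]

/-- In `R[u, v, w]` (`u = X 0`, `v = X 1`, `w = X 2`): if `γ · w² ∈ (u, v)` then `γ ∈ (u, v)`
(the monomial ideal `(u, v)` is saturated with respect to `w`). [folklore] -/
theorem mem_span_u_v_of_mul_w_sq_mem {γ : MvPolynomial (Fin 3) R}
    (h : γ * X 2 ^ 2 ∈ Ideal.span ({X 0, X 1} : Set (MvPolynomial (Fin 3) R))) :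
    γ ∈ Ideal.span ({X 0, X 1} : Set (MvPolynomial (Fin 3) R)) := by
  have hset : ({X 0, X 1} : Set (MvPolynomial (Fin 3) R)) = X '' {0, 1} := by
    simp [Set.image_insert_eq]
  rw [hset, mem_ideal_span_X_image] at h ⊢
  intro m hm
  have hm' : m + Finsupp.single 2 1 + Finsupp.single 2 1 ∈ (γ * X 2 ^ 2).support := by
    rw [pow_two, ← mul_assoc, support_mul_X, support_mul_X]
    exact Finset.mem_map_of_mem _ (Finset.mem_map_of_mem _ hm)
  obtain ⟨i, hi, hmi⟩ := h _ hm'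
  refine ⟨i, hi, ?_⟩
  simp only [Set.mem_insert_iff, Set.mem_singleton_iff] at hi
  rcases hi with rfl | rfl <;> simpa using hmi

/-- **The ideal of `X = Σ ∪ R`.** In `R[u, v, w]`, the intersection of the ideal `(u, v)` of the line
`Σ = {u = v = 0}` (the `w`-axis) with the ideal `(u − w², v − w³)` of the smooth curve
`R = {u = w², v = w³}` (which lies on the cuspidal cylinder `v² = u³` and meets `Σ` at the origin) is
`(v − u w, u (u − w²))`: `X` is a complete intersection, the tacnode `u (u − w²) = 0` inside the smooth
surface germ `v = u w`. [folklore] -/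
theorem span_inf_span_eq :
    Ideal.span ({X 0, X 1} : Set (MvPolynomial (Fin 3) R)) ⊓
        Ideal.span {X 0 - X 2 ^ 2, X 1 - X 2 ^ 3} =
      Ideal.span {X 1 - X 0 * X 2, X 0 * (X 0 - X 2 ^ 2)} := by
  apply le_antisymm
  · intro f hf
    obtain ⟨hf1, hf2⟩ := Submodule.mem_inf.mp hf
    obtain ⟨α, β, rfl⟩ := Ideal.mem_span_pair.mp hf2
    -- `f = (α + β w)(u − w²) + β (v − u w)`
    have key : α * (X 0 - X 2 ^ 2) + β * (X 1 - X 2 ^ 3) =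
        (α + β * X 2) * (X 0 - X 2 ^ 2) + β * (X 1 - X 0 * X 2) := by ring
    have hvuw : (X 1 - X 0 * X 2 : MvPolynomial (Fin 3) R) ∈
        Ideal.span ({X 0, X 1} : Set (MvPolynomial (Fin 3) R)) := by
      refine Ideal.sub_mem _ (Ideal.subset_span (by simp)) ?_
      exact Ideal.mul_mem_right _ _ (Ideal.subset_span (by simp))
    have hγ : (α + β * X 2) * (X 0 - X 2 ^ 2) ∈
        Ideal.span ({X 0, X 1} : Set (MvPolynomial (Fin 3) R)) := by
      have := Ideal.sub_mem _ hf1 (Ideal.mul_mem_left _ β hvuw)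
      rwa [key, add_sub_cancel_right] at this
    -- hence `(α + β w) w² ∈ (u, v)` and `α + β w ∈ (u, v)`
    have hγ' : (α + β * X 2) * X 2 ^ 2 ∈
        Ideal.span ({X 0, X 1} : Set (MvPolynomial (Fin 3) R)) := by
      have hu : (α + β * X 2) * X 0 ∈ Ideal.span ({X 0, X 1} : Set (MvPolynomial (Fin 3) R)) :=
        Ideal.mul_mem_left _ _ (Ideal.subset_span (by simp))
      have := Ideal.sub_mem _ hu hγ
      rwa [← mul_sub, sub_sub_cancel] at this
    obtain ⟨γ₁, γ₂, hγ12⟩ := Ideal.mem_span_pair.mp (mem_span_u_v_of_mul_w_sq_mem hγ')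
    rw [key, ← hγ12]
    -- `(γ₁ u + γ₂ v)(u − w²) + β (v − uw) = (γ₂ (u − w²) + β)(v − uw) + (γ₁ + γ₂ w) · u (u − w²)`
    have e : (γ₁ * X 0 + γ₂ * X 1) * (X 0 - X 2 ^ 2) + β * (X 1 - X 0 * X 2) =
        (γ₂ * (X 0 - X 2 ^ 2) + β) * (X 1 - X 0 * X 2) +
          (γ₁ + γ₂ * X 2) * (X 0 * (X 0 - X 2 ^ 2)) := by ring
    rw [e]
    exact Ideal.add_mem _ (Ideal.mul_mem_left _ _ (Ideal.subset_span (by simp)))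
      (Ideal.mul_mem_left _ _ (Ideal.subset_span (by simp)))
  · rw [Ideal.span_le]
    intro f hf
    simp only [Set.mem_insert_iff, Set.mem_singleton_iff] at hf
    rcases hf with rfl | rfl
    · refine Submodule.mem_inf.mpr ⟨?_, ?_⟩
      · exact Ideal.sub_mem _ (Ideal.subset_span (by simp))
          (Ideal.mul_mem_right _ _ (Ideal.subset_span (by simp)))
      · have e : (X 1 - X 0 * X 2 : MvPolynomial (Fin 3) R) =
            (X 1 - X 2 ^ 3) - X 2 * (X 0 - X 2 ^ 2) := by ring
        rw [e]
        exact Ideal.sub_mem _ (Ideal.subset_span (by simp))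
          (Ideal.mul_mem_left _ _ (Ideal.subset_span (by simp)))
    · refine Submodule.mem_inf.mpr ⟨?_, ?_⟩
      · exact Ideal.mul_mem_right _ _ (Ideal.subset_span (by simp))
      · exact Ideal.mul_mem_left _ _ (Ideal.subset_span (by simp))

end IdealOfX

/-! ## The cuspidal cylinder `H = {v² = u³} × 𝔸¹_w`, normalised by `(s, w) ↦ (s², s³, w)` -/

section CuspModel

variable {k : Type u} [Field k]

/-- The parametrisation `(u, v, w) ↦ (s², s³, w)` kills the equation `v² − u³` of `H`. [folklore] -/
theorem cuspParam_eq_zero (φ : MvPolynomial (Fin 3) k →ₐ[k] MvPolynomial (Fin 2) k)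
    (hφ : φ = aeval ![X 0 ^ 2, X 0 ^ 3, X 1]) :
    φ (X 1 ^ 2 - X 0 ^ 3) = 0 := by
  subst hφ
  simp only [map_sub, map_pow, aeval_X, Matrix.cons_val_zero, Matrix.cons_val_one]
  ring

/-- Values of the parametrisation on the coordinates. [folklore] -/
theorem cuspParam_X (φ : MvPolynomial (Fin 3) k →ₐ[k] MvPolynomial (Fin 2) k)
    (hφ : φ = aeval ![X 0 ^ 2, X 0 ^ 3, X 1]) :
    φ (X 0) = X 0 ^ 2 ∧ φ (X 1) = X 0 ^ 3 ∧ φ (X 2) = X 1 := by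
  subst hφ
  refine ⟨?_, ?_, ?_⟩ <;> simp

/-- **`s ∉ k[s², s³, w]`**: the coordinate ring `k[s², s³, w]` of `H` (the image of the
parametrisation) does not contain `s` — tested with the dual-number point `s ↦ ε`, `w ↦ 0`, which
sends `s², s³, w` to `0`. [folklore] -/
theorem X_zero_notMem_range (φ : MvPolynomial (Fin 3) k →ₐ[k] MvPolynomial (Fin 2) k)
    (hφ : φ = aeval ![X 0 ^ 2, X 0 ^ 3, X 1]) :
    (X 0 : MvPolynomial (Fin 2) k) ∉ φ.range := by
  rintro ⟨g, hg⟩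
  let θ : MvPolynomial (Fin 2) k →ₐ[k] DualNumber k := aeval ![DualNumber.eps, 0]
  have hθφ : ∀ i : Fin 3, θ (![X 0 ^ 2, X 0 ^ 3, X 1] i) = 0 := by
    intro i
    fin_cases i
    · simp [θ, pow_two, DualNumber.eps_mul_eps]
    · simp [θ, pow_succ, DualNumber.eps_mul_eps]
    · simp [θ]
  have h1 : θ (φ g) = algebraMap k (DualNumber k) (constantCoeff g) := by
    rw [hφ, comp_aeval_apply]
    have : (fun i => θ (![X 0 ^ 2, X 0 ^ 3, X 1] i)) = (0 : Fin 3 → DualNumber k) :=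
      funext fun i => hθφ i
    rw [this, aeval_zero]
  have h2 : TrivSqZeroExt.snd (θ (φ g)) = 0 := by
    rw [h1, TrivSqZeroExt.algebraMap_eq_inl, TrivSqZeroExt.snd_inl]
  have h3 : TrivSqZeroExt.snd (θ (X 0)) = 1 := by
    simp [θ]
  have hg' : φ g = X 0 := hg
  rw [hg'] at h2
  rw [h2] at h3
  exact zero_ne_one h3

/-- `k[s, w] = k[s², s³, w] + s · k[s², s³, w]`: every polynomial is `ρ₀ + s ρ₁` with `ρ₀, ρ₁` in
the coordinate ring of `H`. [folklore] -/
theorem exists_add_X_mul_of_range (φ : MvPolynomial (Fin 3) k →ₐ[k] MvPolynomial (Fin 2) k)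
    (hφ : φ = aeval ![X 0 ^ 2, X 0 ^ 3, X 1]) (β : MvPolynomial (Fin 2) k) :
    ∃ ρ₀ ∈ φ.range, ∃ ρ₁ ∈ φ.range, β = ρ₀ + X 0 * ρ₁ := by
  obtain ⟨hφ0, hφ1, hφ2⟩ := cuspParam_X φ hφ
  induction β using MvPolynomial.induction_on with
  | C c => exact ⟨C c, ⟨C c, by simp⟩, 0, Subalgebra.zero_mem _, by simp⟩
  | add p q hp hq =>
    obtain ⟨ρ₀, hρ₀, ρ₁, hρ₁, rfl⟩ := hp
    obtain ⟨ρ₀', hρ₀', ρ₁', hρ₁', rfl⟩ := hq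
    exact ⟨ρ₀ + ρ₀', Subalgebra.add_mem _ hρ₀ hρ₀', ρ₁ + ρ₁', Subalgebra.add_mem _ hρ₁ hρ₁',
      by ring⟩
  | mul_X p i hp =>
    obtain ⟨ρ₀, hρ₀, ρ₁, hρ₁, rfl⟩ := hp
    have hs2 : (X 0 ^ 2 : MvPolynomial (Fin 2) k) ∈ φ.range := ⟨X 0, hφ0⟩
    have hw : (X 1 : MvPolynomial (Fin 2) k) ∈ φ.range := ⟨X 2, hφ2⟩
    fin_cases i
    · exact ⟨X 0 ^ 2 * ρ₁, Subalgebra.mul_mem _ hs2 hρ₁, ρ₀, hρ₀, by simp; ring⟩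
    · exact ⟨ρ₀ * X 1, Subalgebra.mul_mem _ hρ₀ hw, ρ₁ * X 1, Subalgebra.mul_mem _ hρ₁ hw,
        by simp; ring⟩

/-! ### The trace `I = I_X · 𝒪_H` of the junction ideal on `H` -/

/-- Coercion of `φ.rangeRestrict`. [folklore] -/
theorem coe_rangeRestrict_apply (φ : MvPolynomial (Fin 3) k →ₐ[k] MvPolynomial (Fin 2) k)
    (x : MvPolynomial (Fin 3) k) : ((φ.rangeRestrict x : φ.range) : MvPolynomial (Fin 2) k) = φ x :=
  rfl

/-- **Dictionary.** The trace on `H` of the ideal `I_X = (u, v) ∩ (u − w², v − w³)` of `X = Σ ∪ R`,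
i.e. its image in the coordinate ring `k[s², s³, w]` of `H`, is the ideal generated by the images
`s³ − s²w = s²(s − w)` of `v − uw` and `s⁴ − s²w² = s²(s − w)(s + w)` of `u(u − w²)`. [folklore] -/
theorem map_rangeRestrict_junctionIdeal (φ : MvPolynomial (Fin 3) k →ₐ[k] MvPolynomial (Fin 2) k)
    (I : Ideal φ.range)
    (hI : I = Ideal.span {φ.rangeRestrict (X 1 - X 0 * X 2), φ.rangeRestrict (X 0 * (X 0 - X 2 ^ 2))}) :
    (Ideal.span ({X 0, X 1} : Set (MvPolynomial (Fin 3) k)) ⊓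
        Ideal.span {X 0 - X 2 ^ 2, X 1 - X 2 ^ 3}).map φ.rangeRestrict = I := by
  rw [span_inf_span_eq, Ideal.map_span, Set.image_insert_eq, Set.image_singleton, hI]

/-- The two generators in `k[s, w]`: `s³ − s²w` and `s⁴ − s²w² = (s³ − s²w)(s + w)`. [folklore] -/
theorem cuspParam_gens (φ : MvPolynomial (Fin 3) k →ₐ[k] MvPolynomial (Fin 2) k)
    (hφ : φ = aeval ![X 0 ^ 2, X 0 ^ 3, X 1]) :
    φ (X 1 - X 0 * X 2) = X 0 ^ 3 - X 0 ^ 2 * X 1 ∧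
      φ (X 0 * (X 0 - X 2 ^ 2)) = (X 0 ^ 3 - X 0 ^ 2 * X 1) * (X 0 + X 1) ∧
      φ (X 0 ^ 2 - X 1 * X 2) = (X 0 ^ 3 - X 0 ^ 2 * X 1) * X 0 := by
  obtain ⟨h0, h1, h2⟩ := cuspParam_X φ hφ
  refine ⟨?_, ?_, ?_⟩
  · rw [map_sub, map_mul, h0, h1, h2]
  · rw [map_mul, map_sub, map_pow, h0, h2]; ring
  · rw [map_sub, map_mul, map_pow, h0, h1, h2]; ring

/-- `s³ − s²w ≠ 0` in `k[s, w]` (it takes the value `1` at `(s, w) = (1, 0)`). [folklore] -/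
theorem gen_ne_zero : (X 0 ^ 3 - X 0 ^ 2 * X 1 : MvPolynomial (Fin 2) k) ≠ 0 := by
  intro h
  have := congrArg (MvPolynomial.eval ![(1 : k), 0]) h
  simp at this

/-- `(s³ − s²w) · k[s, w] ⊆ k[s², s³, w]`: `s²(s − w)` is a universal denominator (it lies in the
conductor `s² k[s, w]`). [folklore] -/
theorem gen_mul_mem_range (φ : MvPolynomial (Fin 3) k →ₐ[k] MvPolynomial (Fin 2) k)
    (hφ : φ = aeval ![X 0 ^ 2, X 0 ^ 3, X 1]) (β : MvPolynomial (Fin 2) k) :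
    (X 0 ^ 3 - X 0 ^ 2 * X 1) * β ∈ φ.range := by
  obtain ⟨ρ₀, hρ₀, ρ₁, hρ₁, rfl⟩ := exists_add_X_mul_of_range φ hφ β
  obtain ⟨ha, -, has⟩ := cuspParam_gens φ hφ
  have ha' : (X 0 ^ 3 - X 0 ^ 2 * X 1 : MvPolynomial (Fin 2) k) ∈ φ.range := ⟨_, ha⟩
  have has' : ((X 0 ^ 3 - X 0 ^ 2 * X 1) * X 0 : MvPolynomial (Fin 2) k) ∈ φ.range := ⟨_, has⟩
  have e : (X 0 ^ 3 - X 0 ^ 2 * X 1) * (ρ₀ + X 0 * ρ₁) =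
      (X 0 ^ 3 - X 0 ^ 2 * X 1) * ρ₀ + (X 0 ^ 3 - X 0 ^ 2 * X 1) * X 0 * ρ₁ := by ring
  rw [e]
  exact Subalgebra.add_mem _ (Subalgebra.mul_mem _ ha' hρ₀) (Subalgebra.mul_mem _ has' hρ₁)

/-- **`I = (s³ − s²w) · k[s, w]`**: an element of `k[s², s³, w]` lies in the trace ideal `I` iff it is
a multiple of `s²(s − w)` in `k[s, w]` (so `I` is the conductor-type ideal `c · Ã` of
`NormalizationAsBlowup.lean` for the universal denominator `c = s²(s − w)`). [folklore] -/
theorem mem_traceIdeal_iff (φ : MvPolynomial (Fin 3) k →ₐ[k] MvPolynomial (Fin 2) k)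
    (hφ : φ = aeval ![X 0 ^ 2, X 0 ^ 3, X 1]) (I : Ideal φ.range)
    (hI : I = Ideal.span {φ.rangeRestrict (X 1 - X 0 * X 2), φ.rangeRestrict (X 0 * (X 0 - X 2 ^ 2))})
    (x : φ.range) :
    x ∈ I ↔ ∃ β : MvPolynomial (Fin 2) k, (x : MvPolynomial (Fin 2) k) = (X 0 ^ 3 - X 0 ^ 2 * X 1) * β := by
  obtain ⟨ha, hb, has⟩ := cuspParam_gens φ hφ
  obtain ⟨-, -, h2⟩ := cuspParam_X φ hφ
  subst hI
  constructor
  · intro hx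
    obtain ⟨r₁, r₂, rfl⟩ := Ideal.mem_span_pair.mp hx
    refine ⟨(r₁ : MvPolynomial (Fin 2) k) + (r₂ : MvPolynomial (Fin 2) k) * (X 0 + X 1), ?_⟩
    simp only [Subalgebra.coe_add, Subalgebra.coe_mul, coe_rangeRestrict_apply, ha, hb]
    ring
  · rintro ⟨β, hβ⟩
    obtain ⟨ρ₀, hρ₀, ρ₁, hρ₁, rfl⟩ := exists_add_X_mul_of_range φ hφ β
    -- `x = g₁ (ρ₀ − w ρ₁) + g₂ ρ₁` with `g₁ = s³ − s²w`, `g₂ = g₁ (s + w)`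
    refine Ideal.mem_span_pair.mpr
      ⟨⟨ρ₀, hρ₀⟩ - φ.rangeRestrict (X 2) * ⟨ρ₁, hρ₁⟩, ⟨ρ₁, hρ₁⟩, Subtype.ext ?_⟩
    simp only [Subalgebra.coe_add, Subalgebra.coe_mul, Subalgebra.coe_sub, coe_rangeRestrict_apply,
      ha, hb, h2, hβ]
    ring

/-- **`I · 𝒪_H` is not principal** (the centre `X` is «useful»: blowing it up is not an isomorphism
on `H`). If `I = (h)` then `h = c · s²(s − w)` for a constant `c` and `s ∈ k[s², s³, w]`, absurd.
[folklore] -/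
theorem traceIdeal_not_isPrincipal (φ : MvPolynomial (Fin 3) k →ₐ[k] MvPolynomial (Fin 2) k)
    (hφ : φ = aeval ![X 0 ^ 2, X 0 ^ 3, X 1]) (I : Ideal φ.range)
    (hI : I = Ideal.span {φ.rangeRestrict (X 1 - X 0 * X 2), φ.rangeRestrict (X 0 * (X 0 - X 2 ^ 2))}) :
    ¬ I.IsPrincipal := by
  rintro ⟨h, hh⟩
  obtain ⟨ha, hb, has⟩ := cuspParam_gens φ hφ
  have hmem := mem_traceIdeal_iff φ hφ I hI
  -- `h = g₁ β`
  have hhI : h ∈ I := by rw [hh]; exact Ideal.mem_span_singleton_self h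
  obtain ⟨β, hβ⟩ := (hmem h).mp hhI
  -- `g₁ = r₀ h`
  have hg1I : φ.rangeRestrict (X 1 - X 0 * X 2) ∈ I := by
    rw [hI]; exact Ideal.subset_span (by simp)
  rw [hh] at hg1I
  obtain ⟨r₀, hr₀⟩ := Ideal.mem_span_singleton'.mp hg1I
  have e1 : (r₀ : MvPolynomial (Fin 2) k) * ((X 0 ^ 3 - X 0 ^ 2 * X 1) * β) =
      X 0 ^ 3 - X 0 ^ 2 * X 1 := by
    rw [← hβ, ← ha, ← coe_rangeRestrict_apply φ, ← hr₀, Subalgebra.coe_mul]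
  -- hence `r₀ β = 1` and `β` is a constant
  have e2 : (r₀ : MvPolynomial (Fin 2) k) * β = 1 := by
    have : (X 0 ^ 3 - X 0 ^ 2 * X 1 : MvPolynomial (Fin 2) k) * ((r₀ : MvPolynomial (Fin 2) k) * β - 1) = 0 := by
      linear_combination e1
    rcases mul_eq_zero.mp this with h0 | h0
    · exact absurd h0 gen_ne_zero
    · exact sub_eq_zero.mp h0
  have hβu : IsUnit β := IsUnit.of_mul_eq_one _ (by rw [mul_comm]; exact e2)
  obtain ⟨c, -, rfl⟩ := (MvPolynomial.isUnit_iff_eq_C_of_isReduced).mp hβu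
  -- `g₁ s ∈ I = (h)`: `g₁ s = r₁ h = r₁ g₁ c`, so `s = c r₁ ∈ k[s², s³, w]`
  have hsI : φ.rangeRestrict (X 0 ^ 2 - X 1 * X 2) ∈ I :=
    (hmem _).mpr ⟨X 0, by rw [coe_rangeRestrict_apply, has]⟩
  rw [hh] at hsI
  obtain ⟨r₁, hr₁⟩ := Ideal.mem_span_singleton'.mp hsI
  have e3 : (r₁ : MvPolynomial (Fin 2) k) * ((X 0 ^ 3 - X 0 ^ 2 * X 1) * C c) =
      (X 0 ^ 3 - X 0 ^ 2 * X 1) * X 0 := by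
    rw [← hβ, ← has, ← coe_rangeRestrict_apply φ, ← hr₁, Subalgebra.coe_mul]
  have e4 : (X 0 : MvPolynomial (Fin 2) k) = c • (r₁ : MvPolynomial (Fin 2) k) := by
    have : (X 0 ^ 3 - X 0 ^ 2 * X 1 : MvPolynomial (Fin 2) k) *
        (X 0 - C c * (r₁ : MvPolynomial (Fin 2) k)) = 0 := by
      linear_combination (-1 : MvPolynomial (Fin 2) k) * e3
    rcases mul_eq_zero.mp this with h0 | h0
    · exact absurd h0 gen_ne_zero
    · rw [smul_eq_C_mul]; exact sub_eq_zero.mp h0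
  exact X_zero_notMem_range φ hφ (e4 ▸ Subalgebra.smul_mem _ r₁.2 c)

/-- **One chart suffices**: every `x ∈ I` has `x² = g₁ · y` with `y ∈ I`, `g₁ = s³ − s²w`
(`x = g₁ β`, `y = g₁ β²`). [folklore] -/
theorem traceIdeal_sq (φ : MvPolynomial (Fin 3) k →ₐ[k] MvPolynomial (Fin 2) k)
    (hφ : φ = aeval ![X 0 ^ 2, X 0 ^ 3, X 1]) (I : Ideal φ.range)
    (hI : I = Ideal.span {φ.rangeRestrict (X 1 - X 0 * X 2), φ.rangeRestrict (X 0 * (X 0 - X 2 ^ 2))}) :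
    ∀ x ∈ I, ∃ y ∈ I, x * x = φ.rangeRestrict (X 1 - X 0 * X 2) * y := by
  intro x hx
  obtain ⟨ha, -, -⟩ := cuspParam_gens φ hφ
  obtain ⟨β, hβ⟩ := (mem_traceIdeal_iff φ hφ I hI x).mp hx
  refine ⟨⟨(X 0 ^ 3 - X 0 ^ 2 * X 1) * (β * β), gen_mul_mem_range φ hφ _⟩,
    (mem_traceIdeal_iff φ hφ I hI _).mpr ⟨β * β, rfl⟩, Subtype.ext ?_⟩
  simp only [Subalgebra.coe_mul, coe_rangeRestrict_apply, ha, hβ]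
  ring

end CuspModel

end Summit.ResolutionOfSingularities.ResolutionOfSingularities.Theorems.EquisingularLift.Junction

end
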